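import Summits.BirchSwinnertonDyer.BirchSwinnertonDyer.Theorems.ByReductionTypeAtTwoOrdKatoHalfAtTwoIsoConjATwoOfPointFieldMu
import Literature.NumberTheory.IwasawaTheory.ClassNumberPExpZeroCyclotomicFour
import Literature.NumberTheory.IwasawaTheory.Fukuda1994Thm1RankProofs
import HarnessLib

/-!
# Route `ByReductionTypeAtTwo` (K4), crux 202 `OrdKatoHalfAtTwoIso` (stmt-BirchSwinnertonDyer-19573), statement (A) at `2`: two KERNEL carriers —
# (A)₂ UNCONDITIONAL for every `E/ℚ` with full rational `2`-torsion (carrier `ℚ(ζ₄)`), and (A)₂ from a Fukuda two-layer class-group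
# certificate on `ℚ(P, √−1)` ALONE (Lim@2 discharged, Fukuda 1994 discharged)

Seat `cruxlead-stmt-BirchSwinnertonDyer-19573-w2` GEN 6 (`--supports stmt-BirchSwinnertonDyer-19573 --as helper`). HONEST FRAMING (cell bsd-2adic):
THEOREMS ONLY — no definition, no named fact, no `sorry`; closes none at the `∀`-level; BSD is not proved by any of this. §1 is UNCONDITIONAL
(no hypothesis beyond the curve having all its `2`-torsion rational); §2 is conditional only on the displayed class-group certificate.

* §1 `divisionField_two_eq_bot_of_forall_smul`, `isPrimitiveRoot_four_of_sq_eq_neg_one`, `isCyclotomicExtension_four_divisionField_two_sup_adjoin`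
  (if `Γ_K` fixes `E[2]` then `K(E[2]) ⊔ K⟮i⟯ = K⟮i⟯` is a fourth cyclotomic extension of `K`); at `K = ℚ`:
  `classicalMuVanishes_divisionField_two_sup_adjoin_of_forall_smul` (EVERY `ℤ₂`-extension of `ℚ(E[2], i) = ℚ(ζ₄)` has `μ = 0`: `h(ℚ(ζ₄)) = 1`
  by Minkowski — `four_pid` — and Iwasawa 1956, both tree theorems) and **`exists_fineSelmerDualData_moduleFinite_two_of_forall_smul_twoTorsion`:
  Coates–Sujatha's statement (A) at `p = 2` (the dual fine Selmer group over `ℚ_∞` is finitely generated over `ℤ₂`, `∃ γ D` form) for EVERY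
  elliptic curve over `ℚ` with `E[2] ⊂ E(ℚ)`, WITH NO HYPOTHESIS** (`Lim2017.thm35_at_two_upstairs_…_holds`, p716773, through
  `LimRelUpstairs.exists_fineSelmerDualData_moduleFinite_of_lim2017`); `finite_fineSelmer_twoTorsion_of_forall_smul_twoTorsion` (intrinsic form).
* §2 `conjA_two_of_fukudaCertificate_pointField_adjoin_I_kernel` — addL2x GEN 9's `AddKatoTwo.conjA_two_of_fukudaCertificate_pointField_adjoin_I` with
  BOTH print binders gone (`hLim2` by the point-field door `PointFieldMu.exists_fineSelmerDualData_moduleFinite_of_classicalMu_pointField_adjoin`,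
  p718233; `hFuk` by `fukuda1994_thm1_classGroupPRank_const_of_succ_eq_holds`): (A)₂ for `W` from ONE two-layer class-group certificate on
  `ℚ(P, i)`; and `fineSelmerConjATwoOrdPosDisc_of_fukudaCertificate_pointField_adjoin_I_kernel` (the lead g7's Q⁺ certificate road, kernel).
  The K4 additive instance rungs `…AdditiveInstance…KatoFine` (`bsdp_two_<L>_of_fukudaCertificate_pointField`, certificate `CERT:F3i`) can drop
  `hLim2`/`hFuk` by this door (D-0152, next touch).

References: [CoatesSujatha2005] Conj. A, Thm. 3.4; [Lim2017FineSelmer] §3 Thm. 3.5, Lemma 3.2; [Washington1997] Thm. 11.1, Prop. 13.22;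
[Greenberg2001IwasawaPastPresent] Prop. 2.1; [Fukuda1994] Thm. 1 (2); tree p716773, p718233.
-/

set_option autoImplicit false
-- the Theorems namespace of this sub repeats the summit name by design (D-0017 nested layout)
set_option linter.dupNamespace false

noncomputable section

open scoped Classical

namespace Summit.BirchSwinnertonDyer.BirchSwinnertonDyer.Theorems.SteinbergFibreAtTwo.PointFieldMu

open WeierstrassCurve NumberField Field
open Literature.NumberTheory.EllipticCurves Literature.NumberTheory.GaloisRepresentations Literature.NumberTheory.IwasawaTheory
  Literature.NumberTheory.EllipticCurves.Rank1Residual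
open Summit.BirchSwinnertonDyer.BirchSwinnertonDyer.Theorems.AlignedTransportAtTwoFineRoad

/-! ## §1 Full rational `2`-torsion: the carrier is `ℚ(ζ₄)`, and statement (A) at `2` is unconditional -/

/-- A square root of `−1` is a primitive fourth root of unity (any field with `2 ≠ 0`). [cite: Washington1997, Ch. 1 (roots of unity)] -/
theorem isPrimitiveRoot_four_of_sq_eq_neg_one {F : Type*} [Field F] (h2 : (2 : F) ≠ 0) {i : F} (hi : i ^ 2 = -1) :
    IsPrimitiveRoot i (2 ^ 2) := by
  have hi1 : i ≠ 1 := by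
    intro h; rw [h, one_pow] at hi; exact h2 (by linear_combination hi)
  refine IsPrimitiveRoot.mk_of_lt i (by norm_num) ?_ fun l hl0 hl4 ↦ ?_
  · rw [show (2 : ℕ) ^ 2 = 2 * 2 by norm_num, pow_mul, hi]; norm_num
  · interval_cases l
    · rw [pow_one]; exact hi1
    · rw [hi]; intro h; exact h2 (by linear_combination -h)
    · intro h
      have h3 : i ^ 3 = -i := by rw [pow_succ, hi]; ring
      rw [h3] at h
      apply hi1
      have : i ^ 2 = 1 := by rw [show i = -1 by linear_combination -h]; norm_num
      rw [hi] at this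
      exact absurd this fun h' ↦ h2 (by linear_combination -h')

section RationalTwoTorsion

variable {K : Type} [Field K] [CharZero K] (W : WeierstrassCurve K) [W.IsElliptic]

omit [W.IsElliptic] in
/-- If `Γ_K` fixes `E[2]` pointwise then `K(E[2]) = K` (the fixed field of `Γ_{K(E[2])} = Γ_K` is `⊥`). [cite: SilvermanAEC2009, VIII.§1] -/
theorem divisionField_two_eq_bot_of_forall_smul (h2 : ∀ (σ : absoluteGaloisGroup K) (T : geomTorsion W ((2 : ℕ) : ℤ)), σ • T = T) :
    W.divisionField 2 = ⊥ := by
  haveI : IsGalois K (AlgebraicClosure K) := {}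
  have htop : fixingSubgroupOfModule K (geomTorsion W ((2 : ℕ) : ℤ)) = ⊤ :=
    eq_top_iff.2 fun σ _ ↦ (W.mem_fixingSubgroupOfModule_geomTorsion_iff 2).2 (h2 σ)
  rw [W.divisionField_def 2, htop]
  exact InfiniteGalois.fixedField_bot

omit [W.IsElliptic] in
/-- **If `Γ_K` fixes `E[2]`, the carrier `K(E[2]) ⊔ K⟮i⟯` (`i² = −1`) is a fourth cyclotomic extension of `K`** (`= K⟮i⟯ = K(ζ₄)`).
[cite: Washington1997, Thm. 11.1 (ℚ(ζ₄) = ℚ(i))] -/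
theorem isCyclotomicExtension_four_divisionField_two_sup_adjoin
    (h2 : ∀ (σ : absoluteGaloisGroup K) (T : geomTorsion W ((2 : ℕ) : ℤ)), σ • T = T) {i : AlgebraicClosure K} (hi : i ^ 2 = -1) :
    IsCyclotomicExtension {2 ^ 2} K ↥(W.divisionField 2 ⊔ IntermediateField.adjoin K ({i} : Set (AlgebraicClosure K))) := by
  have hζ : IsPrimitiveRoot i (2 ^ 2) := isPrimitiveRoot_four_of_sq_eq_neg_one two_ne_zero hi
  have hL : W.divisionField 2 ⊔ IntermediateField.adjoin K ({i} : Set (AlgebraicClosure K)) =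
      IntermediateField.adjoin K ({i} : Set (AlgebraicClosure K)) := by
    rw [divisionField_two_eq_bot_of_forall_smul W h2, bot_sup_eq]
  haveI := hζ.intermediateField_adjoin_isCyclotomicExtension (K := K)
  exact IsCyclotomicExtension.equiv {2 ^ 2} K _ (IntermediateField.equivOfEq hL).symm

end RationalTwoTorsion

section RationalTwoTorsionRat

variable (W : WeierstrassCurve ℚ) [W.IsElliptic]

omit [W.IsElliptic] in
/-- **Iwasawa's `μ = 0` (indeed `e_n = 0`) for EVERY `ℤ₂`-extension of `ℚ(E[2], √−1)` when `E[2] ⊂ E(ℚ)`**: the carrier is `ℚ(ζ₄)`, whose class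
number is `1` (`four_pid`) with one prime above `2` (Iwasawa 1956, tree theorem). Fact-free. [cite: Greenberg2001IwasawaPastPresent, Prop. 2.1 p. 339]
[cite: Washington1997, Thm. 11.1 and Prop. 13.22] -/
theorem classicalMuVanishes_divisionField_two_sup_adjoin_of_forall_smul
    (h2 : ∀ (σ : absoluteGaloisGroup ℚ) (T : geomTorsion W ((2 : ℕ) : ℤ)), σ • T = T) {i : AlgebraicClosure ℚ} (hi : i ^ 2 = -1)
    (κL : ZpExtension ↥(W.divisionField 2 ⊔ IntermediateField.adjoin ℚ ({i} : Set (AlgebraicClosure ℚ))) 2) : ClassicalMuVanishes κL := by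
  haveI : Fact (Nat.Prime 2) := ⟨Nat.prime_two⟩
  have hcyc := isCyclotomicExtension_four_divisionField_two_sup_adjoin W h2 hi
  haveI : NumberField ↥(W.divisionField 2 ⊔ IntermediateField.adjoin ℚ ({i} : Set (AlgebraicClosure ℚ))) :=
    @IsCyclotomicExtension.numberField {2 ^ 2} ℚ _ _ _ _ _ _ hcyc
  exact @classicalMuVanishes_of_isCyclotomicExtension_four _ _ _ _ hcyc κL

/-- **Coates–Sujatha's statement (A) at `p = 2`, UNCONDITIONALLY, for every elliptic curve over `ℚ` with full rational `2`-torsion**: if `Γ_ℚ`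
fixes `E[2]` then for every cyclotomic `ℤ₂`-extension `κ` of `ℚ` some fine Selmer dual datum of `E` over `ℚ_∞` is finitely generated over `ℤ₂`
(`∃ γ D` form). NO hypothesis: Lim 2017 Thm. 3.5 at `2` UPSTAIRS is a tree theorem (p716773) and its `μ₂ = 0` input for the carrier `ℚ(ζ₄)` is
Iwasawa 1956 + `h(ℚ(ζ₄)) = 1`. [cite: CoatesSujatha2005, Conj. A and Thm. 3.4] [cite: Lim2017FineSelmer, §3 Thm. 3.5 and Lemma 3.2]
[cite: Greenberg2001IwasawaPastPresent, Prop. 2.1] -/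
theorem exists_fineSelmerDualData_moduleFinite_two_of_forall_smul_twoTorsion
    (h2 : ∀ (σ : absoluteGaloisGroup ℚ) (T : geomTorsion W ((2 : ℕ) : ℤ)), σ • T = T)
    (κ : ZpExtension ℚ 2) (hκ : κ.IsCyclotomic) :
    ∃ (γ : absoluteGaloisGroup ℚ) (D : W.FineSelmerDualData κ γ), Module.Finite ℤ_[2] (RestrictScalars ℤ_[2] (IwasawaAlgebra 2) D.X) := by
  obtain ⟨i, hi⟩ := IsAlgClosed.exists_pow_nat_eq (-1 : AlgebraicClosure ℚ) two_pos
  exact LimRelUpstairs.exists_fineSelmerDualData_moduleFinite_of_lim2017 W κ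
    Lim2017.thm35_at_two_upstairs_fineSelmer_twoTorsion_finite_of_classicalMuVanishes_holds i hi
    (fun κL _ ↦ classicalMuVanishes_divisionField_two_sup_adjoin_of_forall_smul W h2 hi κL) hκ

/-- Intrinsic form: **`Sel₀(ℚ_∞, E[2^∞])[2]` is finite for every `E/ℚ` with full rational `2`-torsion**, unconditionally.
[cite: CoatesSujatha2005, Conj. A] [cite: LimSujatha2018, §3 (before Prop. 3.2)] -/
theorem finite_fineSelmer_twoTorsion_of_forall_smul_twoTorsion
    (h2 : ∀ (σ : absoluteGaloisGroup ℚ) (T : geomTorsion W ((2 : ℕ) : ℤ)), σ • T = T)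
    (κ : ZpExtension ℚ 2) (hκ : κ.IsCyclotomic) : Set.Finite {s : W.fineSelmerInfty κ | 2 • s = 0} := by
  haveI : Fact (Nat.Prime 2) := ⟨Nat.prime_two⟩
  obtain ⟨γ₀, hγ₀⟩ : ∃ γ₀ : absoluteGaloisGroup ℚ, κ.IsTopGenerator γ₀ := κ.surjective (Multiplicative.ofAdd 1)
  exact (IwasawaModuleFinitePadicInt.exists_fineSelmerDualData_moduleFinite_iff_finite_pTorsion W κ hγ₀).1
    (exists_fineSelmerDualData_moduleFinite_two_of_forall_smul_twoTorsion W h2 κ hκ)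

end RationalTwoTorsionRat

/-! ## §2 The Fukuda certificate on `ℚ(P, √−1)` ALONE gives statement (A) at `2` (Lim@2 and Fukuda 1994 both discharged) -/

section Certificate

variable {K : Type} [Field K] [NumberField K] (W : WeierstrassCurve K) [W.IsElliptic]

/-- **Statement (A) at `(W, 2)` from ONE two-layer class-group certificate on `K(P, √−1)`, KERNEL** (any number field `K`; at `K = ℚ`:: for a non-zero `P ∈ W[2]`, `i² = −1` and a
layer `n₀` such that every cyclotomic `ℤ₂`-extension of `ℚ(P) ⊔ ℚ⟮i⟯` is totally ramified from `n₀` with equal `2`-ranks of the class groups at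
layers `n₀`, `n₀ + 1`, statement (A) holds for `W` at `2` (`∃ γ D` form). addL2x's `AddKatoTwo.conjA_two_of_fukudaCertificate_pointField_adjoin_I`
minus BOTH print binders: Fukuda 1994 Thm. 1 (2) is the tree theorem `fukuda1994_thm1_classGroupPRank_const_of_succ_eq_holds`, Lim@2 is replaced
by the point-field door `exists_fineSelmerDualData_moduleFinite_of_classicalMu_pointField_adjoin` (p718233). The certificate itself stays displayed.
[cite: Fukuda1994, Thm. 1 (2), p. 264] [cite: CoatesSujatha2005, statement (A)] [cite: Lim2017FineSelmer, §3 Thm. 3.5] -/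
theorem conjA_two_of_fukudaCertificate_pointField_adjoin_I_kernel {P : geomTorsion W 2} (hP : P ≠ 0)
    {i : AlgebraicClosure K} (hi : i ^ 2 = -1) (n₀ : ℕ)
    (hcert : ∀ κL : ZpExtension
        ↥(IntermediateField.fixedField (MulAction.stabilizer (absoluteGaloisGroup K) P) ⊔ IntermediateField.adjoin K {i}) 2,
      κL.IsCyclotomic → TotallyRamifiedFrom κL n₀ ∧ classGroupPRank κL (n₀ + 1) = classGroupPRank κL n₀) :
    ∀ (κ : ZpExtension K 2), κ.IsCyclotomic →
      ∃ (γ : absoluteGaloisGroup K) (D : W.FineSelmerDualData κ γ), Module.Finite ℤ_[2] (RestrictScalars ℤ_[2] (IwasawaAlgebra 2) D.X) := by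
  intro κ hκ
  haveI : Fact (Nat.Prime 2) := ⟨Nat.prime_two⟩
  refine exists_fineSelmerDualData_moduleFinite_of_classicalMu_pointField_adjoin W hP hi (fun κL hκL ↦ ?_) κ hκ
  have hint : IsIntegral K i := by
    refine ⟨Polynomial.X ^ 2 + 1, Polynomial.monic_X_pow_add_C _ two_ne_zero, ?_⟩
    simp [hi]
  haveI := IntermediateField.adjoin.finiteDimensional hint
  haveI := AlignedTransportAtTwoTorsionPointField.finiteDimensional_fixedField_stabilizer W P
  haveI : NumberField ↥(IntermediateField.fixedField (MulAction.stabilizer (absoluteGaloisGroup K) P) ⊔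
      IntermediateField.adjoin K ({i} : Set (AlgebraicClosure K))) := NumberField.of_module_finite K _
  exact classicalMuVanishes_of_classGroupPRank_succ_eq fukuda1994_thm1_classGroupPRank_const_of_succ_eq_holds κL
    (hcert κL hκL).1 le_rfl (hcert κL hκL).2

end Certificate

section CertificateRat

/-- **Q⁺ from per-curve Fukuda certificates on the small carrier, KERNEL** — the lead g7's
`fineSelmerConjATwoOrdPosDisc_of_lim_of_fukudaCertificate_pointField_adjoin_I` (p706268) with `hLim2` AND `hFuk` discharged: for every curve of the
cell SOME `P ≠ 0` in `W[2]`, `i² = −1`, `n₀` with the two-layer certificate on `ℚ(P, i)` ⟹ Q⁺. Only the certificates remain displayed (kit/eng data);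
nothing closed. [cite: Fukuda1994, Thm. 1 (2), p. 264] [cite: CoatesSujatha2005, Conj. A] -/
theorem fineSelmerConjATwoOrdPosDisc_of_fukudaCertificate_pointField_adjoin_I_kernel
    (hcert : ∀ (W : WeierstrassCurve ℚ) [W.IsElliptic] [W.IsGloballyMinimal], ¬ W.HasCM → W.analyticRank = 0 →
      GoodOrd W 2 → W.HasSurjectiveModNGaloisRep 2 → 0 < W.Δ →
      ∃ (P : geomTorsion W 2) (i : AlgebraicClosure ℚ) (n₀ : ℕ), P ≠ 0 ∧ i ^ 2 = -1 ∧
        ∀ κL : ZpExtension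
            ↥(IntermediateField.fixedField (MulAction.stabilizer (absoluteGaloisGroup ℚ) P) ⊔ IntermediateField.adjoin ℚ {i}) 2,
          κL.IsCyclotomic → TotallyRamifiedFrom κL n₀ ∧ classGroupPRank κL (n₀ + 1) = classGroupPRank κL n₀) :
    FineSelmerConjATwoOrdPosDisc := by
  intro W _ _ hcm hr hgo h2 hΔ κ hκ
  obtain ⟨P, i, n₀, hP, hi, hc⟩ := hcert W hcm hr hgo h2 hΔ
  exact conjA_two_of_fukudaCertificate_pointField_adjoin_I_kernel W hP hi n₀ hc κ hκ

end CertificateRat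

end Summit.BirchSwinnertonDyer.BirchSwinnertonDyer.Theorems.SteinbergFibreAtTwo.PointFieldMu

end
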